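import Summits.BirchSwinnertonDyer.BirchSwinnertonDyer.Theorems.ClassRecordThreeEulerHalvesAtThreeEichlerShimuraLevelCountC
import Summits.BirchSwinnertonDyer.BirchSwinnertonDyer.Theorems.ClassRecordThreeEulerHalvesAtThreeEichlerShimuraLevelCountD
import HarnessLib

/-!
# Shimura's count `dim H¹_P(Γ, ℝ) = 2g` for a general finite-index level, part E: exactness

Support file for route `ClassRecordThree`, crux `EulerHalvesAtThree` (the `(ES-surj)` step of
`CartanOnePlaceDegreeLawAtThree`), completing parts A–D (`…EichlerShimuraLevelCount{A,B,C,D}`).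
Part C proved `6 dim_ℝ H¹_P(Γ, ℝ) + 3ε₂ + 4ε₃ + 6ε_∞ ≤ 12 + [SL(2, ℤ) : Γ]`; this part shows
that every step of that count is exact, giving the **equality**

`6 dim_ℝ H¹_P(Γ, ℝ) + 3ε₂ + 4ε₃ + 6ε_∞ = 12 + [SL(2, ℤ) : Γ]`   (`six_mul_finrank_parabolicCocycles_eq`)

for every finite-index `Γ ≤ SL(2, ℤ)` containing `-1`, i.e. Shimura's `dim_ℝ H¹_P(Γ, ℝ) = 2g(Γ)`
((8.2.24) with Prop. 8.3 for `n = 0`, and the genus formula Prop. 1.40), `H¹_P(Γ, ℝ)` being the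
space `parabolicCocycles Γ` of additive `u : Γ → ℝ` vanishing on parabolic elements.

## Proof
* **`Λ` is onto the solution space `W`** (`solSpace_le_range_lam`, `range_lam_eq`): for
  `(a, b) ∈ W`, part D's `exists_rc` gives a cocycle `E` with `E(S) = a`, `E(T) = b`; its
  restriction `u` is a parabolic cocycle (`rc_apply_coe_one_eq_zero_of_isParabolic`, the cusp
  sums of `b` being zero) and `E = E_u + δf` (`rc_eq_tot`), so `(a, b) = Λ(u, f)`.
* `dim ker Λ = 1` (`finrank_ker_lam_eq_one`: `(0, 1) ∈ ker Λ`).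
* `ker(1 + U^* + U^{*2}) + ker(cusp sums) = ker(total sum)` (`ker_sup_ker_eq_ker_total`: exact
  codimension `1`, from part A's `card_le_finrank_ker_sup_add_one`), and it contains
  `ker(1 + S^*)`; hence the projection `W → ker(1 + S^*)` is onto, and
  `dim W = dim ker(1 + S^*) + dim(ker(1 + U^* + U^{*2}) ∩ ker(cusp sums))` (`finrank_solSpace_eq`).
* The trace counts of part A (`2 rk(1 + S^*) = μ + ε₂`, `3 rk(1 + U^* + U^{*2}) = μ + 2ε₃`,
  `rk(cusp sums) = ε_∞`) finish the computation.

No modular forms are used.  (With the Eichler–Shimura injection and surjection of the companion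
files `…EichlerShimuraLevelGamma1`/`…LevelGamma` this yields the genus formula
`dim_ℂ S₂(Γ) = g(Γ)` for congruence `Γ ∋ -1`.)

References: [cite: ShimuraIATAF1971, §8.1–8.2, (8.2.24), Prop. 8.3, Prop. 1.40];
[cite: Brown1982, III.6]; [folklore] for the linear algebra.
-/

open scoped MatrixGroups ModularForm

open CongruenceSubgroup Matrix.SpecialLinearGroup ModularGroup

set_option linter.dupNamespace false

namespace Summit.BirchSwinnertonDyer.BirchSwinnertonDyer.Theorems.EichlerShimuraLevel

open _root_.Module _root_.LinearMap
open Literature.NumberTheory.EllipticCurves.ModularForms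
open scoped Classical

variable {Γ : Subgroup SL(2, ℤ)}

/-! ### The total-sum functional -/

section Total

variable [Fintype (SL(2, ℤ) ⧸ Γ)]

variable (Γ) in
/-- The total sum `f ↦ ∑_x f(x)` on `ℝ^X`. [folklore] -/
def total : ((SL(2, ℤ) ⧸ Γ) → ℝ) →ₗ[ℝ] ℝ where
  toFun f := ∑ x, f x
  map_add' f g := by simp [Finset.sum_add_distrib]
  map_smul' r f := by simp [Finset.mul_sum]

/-- Unfolding `total`. [folklore] -/
@[simp] theorem total_apply (f : (SL(2, ℤ) ⧸ Γ) → ℝ) : total Γ f = ∑ x, f x := rfl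

/-- The total sum is `g^*`-invariant. [folklore] -/
theorem total_coperm (g : SL(2, ℤ)) (f : (SL(2, ℤ) ⧸ Γ) → ℝ) :
    total Γ (coperm Γ g f) = total Γ f := by
  simp only [total_apply, coperm_apply]
  exact Fintype.sum_equiv (MulAction.toPerm g) (fun x ↦ f (g • x)) f fun _ ↦ rfl

/-- `ker(1 + U^* + U^{*2}) ≤ ker(total)` (`total ∘ (1 + U^* + U^{*2}) = 3 · total`). [folklore] -/
theorem ker_relST_le_ker_total : LinearMap.ker (relST Γ) ≤ LinearMap.ker (total Γ) := by
  intro c hc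
  rw [LinearMap.mem_ker] at hc ⊢
  have h := congrArg (total Γ) hc
  rw [map_zero] at h
  simp only [relST, LinearMap.add_apply, LinearMap.id_apply, LinearMap.comp_apply, map_add,
    total_coperm] at h
  linarith

/-- `ker(1 + S^*) ≤ ker(total)` (`total ∘ (1 + S^*) = 2 · total`). [folklore] -/
theorem ker_relS_le_ker_total : LinearMap.ker (relS Γ) ≤ LinearMap.ker (total Γ) := by
  intro a ha
  rw [LinearMap.mem_ker] at ha ⊢
  have h := congrArg (total Γ) ha
  rw [map_zero] at h
  simp only [relS, LinearMap.add_apply, LinearMap.id_apply, map_add, total_coperm] at h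
  linarith

/-- `dim ker(total) + 1 = #X`. [folklore] -/
theorem finrank_ker_total_add_one :
    finrank ℝ (LinearMap.ker (total Γ)) + 1 = Fintype.card (SL(2, ℤ) ⧸ Γ) := by
  have hsurj : Function.Surjective (total Γ) := fun r ↦
    ⟨fun x ↦ if x = ((1 : SL(2, ℤ)) : (SL(2, ℤ) ⧸ Γ)) then r else 0, by simp⟩
  have h := LinearMap.finrank_range_add_finrank_ker (total Γ)
  rw [LinearMap.range_eq_top.mpr hsurj, finrank_top, Module.finrank_self,
    finrank_fintype_fun_eq_card] at h
  omega

end Total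

/-! ### `Λ` is onto the solution space -/

section Finite

variable [Γ.FiniteIndex]

/-- **`W ⊆ range Λ`**: every solution `(a, b)` is `((E_u + δf)(S), (E_u + δf)(T))` for a parabolic
cocycle `u` and some `f ∈ ℝ^X` (`exists_rc`, `rc_apply_coe_one_eq_zero_of_isParabolic`,
`rc_eq_tot`). [cite: ShimuraIATAF1971, §8.1–8.2] -/
theorem solSpace_le_range_lam [Fact ((-1 : SL(2, ℤ)) ∈ Γ)] :
    solSpace Γ ≤ LinearMap.range (lam Γ) := by
  rintro ⟨a, b⟩ hp
  obtain ⟨ha, hab, hb⟩ := (mem_solSpace_iff Γ _).mp hp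
  obtain ⟨E, hE, hES, hET⟩ := exists_rc ha hab
  have hcusp : cuspSum Γ (E T) = 0 := by rw [hET]; exact hb
  have hpar : (fun γ : Γ ↦ E γ ((1 : SL(2, ℤ)) : (SL(2, ℤ) ⧸ Γ))) ∈ parabolicCocycles Γ :=
    ⟨fun γ δ ↦ rc_apply_coe_one_mul hE γ δ,
      fun γ hγ ↦ rc_apply_coe_one_eq_zero_of_isParabolic hE hcusp γ hγ⟩
  obtain ⟨f, hf⟩ := rc_eq_tot hE
  refine ⟨(⟨_, hpar⟩, f), ?_⟩
  rw [lam_apply, Prod.mk.injEq]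
  exact ⟨(hf S).symm.trans hES, (hf T).symm.trans hET⟩

/-- **`range Λ = W`.** [cite: ShimuraIATAF1971, §8.2] -/
theorem range_lam_eq [Fact ((-1 : SL(2, ℤ)) ∈ Γ)] : LinearMap.range (lam Γ) = solSpace Γ :=
  le_antisymm (range_lam_le Γ) solSpace_le_range_lam

/-- **`dim ker Λ = 1`** (`(0, 1) ∈ ker Λ`, and part C's `finrank_ker_lam_le_one`). [folklore] -/
theorem finrank_ker_lam_eq_one : finrank ℝ (LinearMap.ker (lam Γ)) = 1 := by
  refine le_antisymm (finrank_ker_lam_le_one Γ) ?_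
  haveI : FiniteDimensional ℝ (parabolicCocycles Γ) := finiteDimensional_parabolicCocycles Γ
  letI : Fintype (SL(2, ℤ) ⧸ Γ) := Fintype.ofFinite _
  have htot : ∀ g : SL(2, ℤ),
      tot ((0 : parabolicCocycles Γ) : Γ → ℝ) (fun _ : SL(2, ℤ) ⧸ Γ ↦ (1 : ℝ)) g = 0 := fun g ↦ by
    funext x
    simp [tot, cobd]
  have hmem : ((0 : parabolicCocycles Γ), fun _ : SL(2, ℤ) ⧸ Γ ↦ (1 : ℝ)) ∈
      LinearMap.ker (lam Γ) := by
    rw [LinearMap.mem_ker, lam_apply, htot S, htot T]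
    rfl
  have hne : ((0 : parabolicCocycles Γ), fun _ : SL(2, ℤ) ⧸ Γ ↦ (1 : ℝ)) ≠ 0 := by
    intro h
    have h' := congrArg (fun p : parabolicCocycles Γ × ((SL(2, ℤ) ⧸ Γ) → ℝ) ↦
      p.2 ((1 : SL(2, ℤ)) : (SL(2, ℤ) ⧸ Γ))) h
    simp at h'
  have hle : (ℝ ∙ ((0 : parabolicCocycles Γ), fun _ : SL(2, ℤ) ⧸ Γ ↦ (1 : ℝ))) ≤
      LinearMap.ker (lam Γ) := by
    rw [Submodule.span_singleton_le_iff_mem]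
    exact hmem
  calc 1 = finrank ℝ (ℝ ∙ ((0 : parabolicCocycles Γ), fun _ : SL(2, ℤ) ⧸ Γ ↦ (1 : ℝ))) :=
      (finrank_span_singleton hne).symm
    _ ≤ finrank ℝ (LinearMap.ker (lam Γ)) := Submodule.finrank_mono hle

/-! ### The exact codimension and the dimension of the solution space -/

variable [Fintype (SL(2, ℤ) ⧸ Γ)]

/-- `ker(cusp sums) ≤ ker(total)` (the total is the sum of the cusp sums). [folklore] -/
theorem ker_cuspSum_le_ker_total : LinearMap.ker (cuspSum Γ) ≤ LinearMap.ker (total Γ) := by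
  intro f hf
  rw [LinearMap.mem_ker] at hf ⊢
  rw [total_apply, ← Finset.sum_fiberwise_of_maps_to (s := Finset.univ) (t := Level.basePoints Γ)
    (g := Level.base Γ) (fun x _ ↦ Level.base_mem_basePoints x) f]
  refine Finset.sum_eq_zero fun p hp ↦ ?_
  have h := congrFun hf ⟨p, hp⟩
  rw [cuspSum_apply, ← Level.filter_base_eq p (Finset.mem_filter.mp hp).2, Pi.zero_apply] at h
  convert h using 3
  exact Finset.ext fun x ↦ by simp

/-- **`ker(1 + U^* + U^{*2}) + ker(cusp sums) = ker(total)`** (exact codimension one; the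
dimension bound is part A's `card_le_finrank_ker_sup_add_one`). [folklore] -/
theorem ker_sup_ker_eq_ker_total [Fact ((-1 : SL(2, ℤ)) ∈ Γ)] :
    LinearMap.ker (relST Γ) ⊔ LinearMap.ker (cuspSum Γ) = LinearMap.ker (total Γ) := by
  apply Submodule.eq_of_le_of_finrank_le (sup_le ker_relST_le_ker_total ker_cuspSum_le_ker_total)
  have h1 := card_le_finrank_ker_sup_add_one (Γ := Γ)
  have h2 := finrank_ker_total_add_one (Γ := Γ)
  omega

/-- **`dim W = dim ker(1 + S^*) + dim(ker(1 + U^* + U^{*2}) ∩ ker(cusp sums))`**: the projection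
of `W` to the first factor is onto `ker(1 + S^*)` (by `ker_sup_ker_eq_ker_total`, every
`a ∈ ker(1 + S^*)` is `c + d` with `(1 + U^* + U^{*2})c = 0` and `d` of cusp sums zero; then
`(a, c - T^*a) ∈ W`), with fibre `ker(1 + U^* + U^{*2}) ∩ ker(cusp sums)`. [folklore] -/
theorem finrank_solSpace_eq [Fact ((-1 : SL(2, ℤ)) ∈ Γ)] :
    finrank ℝ (solSpace Γ) = finrank ℝ (LinearMap.ker (relS Γ)) +
      finrank ℝ ↥(LinearMap.ker (relST Γ) ⊓ LinearMap.ker (cuspSum Γ)) := by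
  let π : solSpace Γ →ₗ[ℝ] ((SL(2, ℤ) ⧸ Γ) → ℝ) := LinearMap.fst ℝ _ _ ∘ₗ (solSpace Γ).subtype
  have hπ := LinearMap.finrank_range_add_finrank_ker π
  have hrange : LinearMap.range π = LinearMap.ker (relS Γ) := by
    apply le_antisymm
    · rintro _ ⟨p, rfl⟩
      exact ((mem_solSpace_iff Γ p.1).mp p.2).1
    · intro a ha
      have ha' : a ∈ LinearMap.ker (relST Γ) ⊔ LinearMap.ker (cuspSum Γ) := by
        rw [ker_sup_ker_eq_ker_total]
        exact ker_relS_le_ker_total ha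
      obtain ⟨c, hc, d, hd, hcd⟩ := Submodule.mem_sup.mp ha'
      rw [LinearMap.mem_ker] at ha hc hd
      have hmem : (a, c - coperm Γ T a) ∈ solSpace Γ := by
        rw [mem_solSpace_iff]
        refine ⟨ha, by rwa [add_sub_cancel], ?_⟩
        rw [map_sub, cuspSum_coperm_T, ← hcd, map_add, hd, add_zero, sub_self]
      exact ⟨⟨_, hmem⟩, rfl⟩
  rw [hrange] at hπ
  let ψ : LinearMap.ker π →ₗ[ℝ] ((SL(2, ℤ) ⧸ Γ) → ℝ) :=
    LinearMap.snd ℝ _ _ ∘ₗ (solSpace Γ).subtype ∘ₗ (LinearMap.ker π).subtype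
  have hker : ∀ p : LinearMap.ker π,
      ((p : solSpace Γ) : ((SL(2, ℤ) ⧸ Γ) → ℝ) × ((SL(2, ℤ) ⧸ Γ) → ℝ)).1 = 0 :=
    fun p ↦ LinearMap.mem_ker.mp p.2
  have hψinj : Function.Injective ψ := by
    intro p q hpq
    apply Subtype.ext
    apply Subtype.ext
    exact Prod.ext (by rw [hker p, hker q]) hpq
  have hψrange : LinearMap.range ψ = LinearMap.ker (relST Γ) ⊓ LinearMap.ker (cuspSum Γ) := by
    apply le_antisymm
    · rintro _ ⟨p, rfl⟩
      obtain ⟨-, h2, h3⟩ := (mem_solSpace_iff Γ _).mp (p : solSpace Γ).2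
      rw [hker p, map_zero, zero_add] at h2
      exact ⟨h2, h3⟩
    · rintro c ⟨hc, hc'⟩
      rw [SetLike.mem_coe, LinearMap.mem_ker] at hc hc'
      have hmem : ((0 : (SL(2, ℤ) ⧸ Γ) → ℝ), c) ∈ solSpace Γ := by
        rw [mem_solSpace_iff]
        exact ⟨map_zero _, by rwa [map_zero, zero_add], hc'⟩
      have hmem' : (⟨_, hmem⟩ : solSpace Γ) ∈ LinearMap.ker π := by
        rw [LinearMap.mem_ker]
        rfl
      exact ⟨⟨_, hmem'⟩, rfl⟩
  have h2 := LinearMap.finrank_range_of_inj hψinj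
  rw [hψrange] at h2
  omega

/-! ### The count -/

omit [Fintype (SL(2, ℤ) ⧸ Γ)] in
/-- **Shimura's count `6 dim_ℝ H¹_P(Γ, ℝ) + 3ε₂ + 4ε₃ + 6ε_∞ = 12 + [SL(2, ℤ) : Γ]`** for every
finite-index level `Γ ∋ -1` (`ε₂ = Level.nu₂Level Γ`, `ε₃ = Level.nu₃Level Γ`,
`ε_∞ = #Level.basePoints Γ`), i.e. `dim_ℝ H¹_P(Γ, ℝ) = 2g(Γ)` with
`12(2g - 2) = μ - 3ε₂ - 4ε₃ - 6ε_∞` (Prop. 1.40): the inequality of part C together with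
`dim H¹_P + μ = dim ker Λ + dim W = 1 + (μ - rk(1 + S^*)) + (μ - rk(1 + U^* + U^{*2})) +
(μ - ε_∞) - (μ - 1)`. [cite: ShimuraIATAF1971, §8.2 (8.2.24), Prop. 8.3 (n = 0), Prop. 1.40] -/
theorem six_mul_finrank_parabolicCocycles_eq (hneg : (-1 : SL(2, ℤ)) ∈ Γ) :
    6 * finrank ℝ (parabolicCocycles Γ) + 3 * Level.nu₂Level Γ + 4 * Level.nu₃Level Γ +
        6 * (Level.basePoints Γ).card =
      12 + Γ.index := by
  letI : Fintype (SL(2, ℤ) ⧸ Γ) := Fintype.ofFinite _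
  haveI : Fact ((-1 : SL(2, ℤ)) ∈ Γ) := ⟨hneg⟩
  haveI : FiniteDimensional ℝ (parabolicCocycles Γ) := finiteDimensional_parabolicCocycles Γ
  have hμ : Γ.index = Fintype.card (SL(2, ℤ) ⧸ Γ) := by
    rw [Subgroup.index, Nat.card_eq_fintype_card]
  have hε₂ : Level.nu₂Level Γ = (Finset.univ.filter fun q : (SL(2, ℤ) ⧸ Γ) ↦ S • q = q).card := by
    rw [Level.nu₂Level, Nat.card_eq_fintype_card, Fintype.card_subtype]
  have hε₃ : Level.nu₃Level Γ =
      (Finset.univ.filter fun q : (SL(2, ℤ) ⧸ Γ) ↦ (S * T) • q = q).card := by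
    rw [Level.nu₃Level, Nat.card_eq_fintype_card, Fintype.card_subtype]
  have hS := two_mul_finrank_range_relS (Γ := Γ)
  have hST := three_mul_finrank_range_relST (Γ := Γ)
  have hC := finrank_range_cuspSum (Γ := Γ)
  have hS' := LinearMap.finrank_range_add_finrank_ker (relS Γ)
  have hST' := LinearMap.finrank_range_add_finrank_ker (relST Γ)
  have hC' := LinearMap.finrank_range_add_finrank_ker (cuspSum Γ)
  rw [finrank_fintype_fun_eq_card] at hS' hST' hC'
  have hsup := Submodule.finrank_sup_add_finrank_inf_eq (LinearMap.ker (relST Γ))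
    (LinearMap.ker (cuspSum Γ))
  rw [ker_sup_ker_eq_ker_total] at hsup
  have hcodim := finrank_ker_total_add_one (Γ := Γ)
  have hΛ := LinearMap.finrank_range_add_finrank_ker (lam Γ)
  rw [Module.finrank_prod, finrank_fintype_fun_eq_card, range_lam_eq, finrank_ker_lam_eq_one,
    finrank_solSpace_eq] at hΛ
  rw [hμ, hε₂, hε₃]
  omega

end Finite

end Summit.BirchSwinnertonDyer.BirchSwinnertonDyer.Theorems.EichlerShimuraLevel
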